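import Mathlib
import HarnessLib
import Summits.NavierStokesRegularity.NavierStokesRegularity.Theorems.TaylorModelRungThreeCertificateCloserVC
import Summits.NavierStokesRegularity.NavierStokesRegularity.Theorems.TaylorModelRungThreeCertificateCloserVF
import Summits.NavierStokesRegularity.NavierStokesRegularity.Theorems.TaylorModelRungThreeCertificateReadoutVSoundWinPC
import Summits.NavierStokesRegularity.NavierStokesRegularity.Theorems.TaylorModelRungThreeReadoutVLandWinP

/-!
# Crux K1b-DR (stmt-NavierStokesRegularity-23954), line `taylor-model` — v3 certificate: the CLOSERS for the WINDOWED read-outs with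
# POINCARÉ-CORRECTED base landing (ns-tm-g4 g7, owner of the read-out layer)

The closer shapes of `…CertificateCloserVWin` / `…CloserVWinL` with the read-out Boolean replaced by **`checkReadoutsWinP' kitOf wT A WV`**
(`…CertificateReadoutVInterpWinP`: the windowed read-out step whose base-landing test is the Poincaré-corrected (R9p), `WV : WindowsV`
the emitted crossing windows), wired through `readoutsVP_of_checks'` (`…ReadoutVSoundWinPC`) and the G-side `k1bDR_of_validVP`
(`…ReadoutVLandWinP`, whose base clause is the mean-value proof `baseLanding_ofVP`).  Why: the level-0 BOX read-out (R9w) of the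
windowed step cannot pass on emitted data (a validated enclosure is a needle along the flow; level-0 smear `rate_j·δt ≥` the loop's
`2.8 %` margin, tm-g4 g6 `LEVEL0-RATES-23954.md`), whereas (R9p) reads the base landing THROUGH THE SECTION.  Every other binder is
VERBATIM that of the landed closers (chain Booleans, growth chunk runs, statics, entry tests, kit).

* `k1bDR_of_validVPW` — the crux from `ValidVP` of the interpreted records (window hypothesis of `k1bDR_of_validVP` discharged);
* `k1bDR_of_checksVWinP` — the closer SHAPE (`ReadoutsVP` as the one semantic input);
* `k1bDR_of_checksVRWinP'` — with `readoutsVP_of_checks'` wired in ((R0)–(R3) as hypotheses, (R4) per sub-step from the chunk runs);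
* **`k1bDR_of_checksVRGCWinP'`** (growth VARIANT C, `growthRangeC`, one chunk length `L` — the generator's entry point of record),
  `k1bDR_of_checksVRGFWinP'` (fast v1 growth runs), **`k1bDR_of_checksVRGCWinPL'`** (variant C, PER-STAGE chunk length `Lj j`) — THE
  CLOSERS FROM BOOLEANS.

What remains for the crux is ONE emitted v3 certificate + windows on which these Booleans evaluate to `true`.
MODEL-lattice rung TL-M3 only; nothing here is a statement about the Navier–Stokes equations; K1b-DR is NOT proved here.
-/

-- the sub-problem namespace repeats the summit name by design (D-0017)
set_option linter.dupNamespace false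

namespace Summit.NavierStokesRegularity.NavierStokesRegularity.Theorems.TaylorModelCert

open Literature.Analysis.FluidPDE.TaoCascade Literature.Analysis.FluidPDE.TaoCascade.TaylorChain
open Summit.NavierStokesRegularity.NavierStokesRegularity.Theorems.TaylorModelReadout
open Summit.NavierStokesRegularity.NavierStokesRegularity.Theorems.TaylorModelV

namespace CertTablesV

variable (TV : CertTablesV) (kitOf : ℕ → CoreKit) (wT : ℕ → Array Dyad) (sc : ScalarsV)

/-- **K1b-DR from a valid `ValidVP` certificate** of the interpreted records — `k1bDR_of_validVP` (G-side) with its window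
hypothesis «`Dsc j v = Dsc j (trunc v)`» discharged by `toRadiiW_Dsc_trunc`. [folklore] -/
theorem k1bDR_of_validVPW {ro : ReadoutData} {rw : WinData}
    (hV : ValidVP (TV.toCertDataVW kitOf wT sc) (TV.toBoxesW kitOf wT) (TV.toRadiiW kitOf wT) ro rw) :
    Summit.NavierStokesRegularity.NavierStokesRegularity.Theses.ExactWindowRungThree.DerivativeEnclosureCertificateR :=
  TaylorModelV.k1bDR_of_validVP hV fun j _ v => TV.toRadiiW_Dsc_trunc kitOf wT sc j v

/-- **THE P-WINDOWED v3 CLOSER SHAPE**: as `k1bDR_of_checksV` with the one semantic input `ReadoutsVP … ro rw`. [folklore] -/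
theorem k1bDR_of_checksVWinP {ro : ReadoutData} {rw : WinData} (A : ReadoutAux QS2) (B : StageAux QS2) (B'' : StaticAux QS2)
    (hcoef : TV.base.checkCoef = true) (hS : TV.base.checkStatic B'' = true)
    (hSN : TV.base.checkStageNumerics A B = true) (hk : KitOK TV kitOf) (hC : ChecksOK TV kitOf wT)
    (hK : CoreChecksOK TV wT) (hE : ∀ j, j ≤ TV.base.N₀ → TV.checkEntryV j = true)
    (hRO : ReadoutsVP (TV.toCertDataVW kitOf wT sc) (TV.toBoxesW kitOf wT) (TV.toRadiiW kitOf wT) ro rw) :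
    Summit.NavierStokesRegularity.NavierStokesRegularity.Theses.ExactWindowRungThree.DerivativeEnclosureCertificateR :=
  TV.k1bDR_of_validVPW kitOf wT sc
    ⟨TV.static_of_checkV kitOf wT sc B'' hS, TV.stageNumerics_of_checkV kitOf wT sc A B hcoef hSN,
      chainV_of_checks hk hC hK (entryOK_of_checkEntryV kitOf wT sc hE), hRO⟩

/-- **THE P-WINDOWED v3 CLOSER, CHECKPOINT FORM OF THE READ-OUTS**: as `k1bDR_of_checksVR'` with the read-out Boolean
`checkReadoutsWinP' kitOf wT A WV` and `readoutsVP_of_checks'` wired in. [folklore] -/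
theorem k1bDR_of_checksVRWinP' (WV : WindowsV) (A : ReadoutAux QS2) (B : StageAux QS2) (B'' : StaticAux QS2)
    (hcoef : TV.base.checkCoef = true) (hS : TV.base.checkStatic B'' = true)
    (hSN : TV.base.checkStageNumerics A B = true) (hk : KitOK TV kitOf) (hC : ChecksOK TV kitOf wT)
    (hK : CoreChecksOK TV wT) (hE : ∀ j, j ≤ TV.base.N₀ → TV.checkEntryV j = true)
    (hchk' : TV.checkReadoutsWinP' kitOf wT A WV = true)
    (hR4 : ∀ j, j ≤ TV.base.N₀ → ∀ s, s < (TV.base.stage j).S → TV.base.testR4 TV.MB (TV.AB j) (TV.coreVW kitOf wT j s) = true)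
    {G : ℕ → ℕ → ℕ → ℝ} {ΛT : ℕ → ℝ}
    (hR0 : ∀ j, j ≤ TV.base.N₀ →
      (TV.toCertDataVW kitOf wT sc).Tn j ((TV.toCertDataVW kitOf wT sc).S j) ≤ (TV.toCertDataVW kitOf wT sc).τs ∧
      InPoly (TV.toCertDataVW kitOf wT sc) j ((TV.toCertDataVW kitOf wT sc).x j 0) ∧
      0 < (TV.toCertDataVW kitOf wT sc).γ j ∧ 0 ≤ ΛT j)
    (hR1 : ∀ j, j ≤ TV.base.N₀ → ∀ s', s' ≤ (TV.toCertDataVW kitOf wT sc).S j → ∀ y d : Fin 4 → ℤ → ℝ,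
      InBox (TV.toCertDataVW kitOf wT sc) ((TV.toBoxesW kitOf wT).hlo 1 j s') ((TV.toBoxesW kitOf wT).hhi 1 j s') y →
      (TV.toCertDataVW kitOf wT sc).InBall j d (ΛT j * (TV.toCertDataVW kitOf wT sc).κ j) →
      InBox (TV.toCertDataVW kitOf wT sc) ((TV.toBoxesW kitOf wT).hlo 2 j s') ((TV.toBoxesW kitOf wT).hhi 2 j s') (y + d))
    (hR2 : ∀ j, j ≤ TV.base.N₀ → ∀ s₀ s₁, s₀ ≤ s₁ → s₁ ≤ (TV.toCertDataVW kitOf wT sc).S j → ∀ Ac : ℕ → Ker,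
      (∀ s', s₀ ≤ s' → s' < s₁ →
        KerMem (TV.toCertDataVW kitOf wT sc) (Ac s') ((TV.toBoxesW kitOf wT).Mlo j s') ((TV.toBoxesW kitOf wT).Mhi j s')) →
      ∀ (v : Fin 4 → ℤ → ℝ) (r : ℝ), 0 ≤ r → (TV.toCertDataVW kitOf wT sc).InBall j v r →
        (TV.toCertDataVW kitOf wT sc).InBall j (kiter (TV.toCertDataVW kitOf wT sc) Ac s₀ (s₁ - s₀) v) (G j s₀ s₁ * r))
    (hR3a : ∀ j, j ≤ TV.base.N₀ → ∀ a b, a < (TV.toCertDataVW kitOf wT sc).S j → a + 1 ≤ b →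
      b ≤ (TV.toCertDataVW kitOf wT sc).S j →
      (TV.toCertDataVW kitOf wT sc).L1 j a * G j (a + 1) b ≤ ΛT j ∧
      (b < (TV.toCertDataVW kitOf wT sc).S j →
        (TV.toCertDataVW kitOf wT sc).L1 j a * G j (a + 1) b * (TV.toCertDataVW kitOf wT sc).L1 j b ≤
          (TV.toCertDataVW kitOf wT sc).Λ j))
    (hR3b : ∀ j, j ≤ TV.base.N₀ → ∀ a, a < (TV.toCertDataVW kitOf wT sc).S j →
      (TV.toCertDataVW kitOf wT sc).L1 j a ≤ (TV.toCertDataVW kitOf wT sc).Λ j) :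
    Summit.NavierStokesRegularity.NavierStokesRegularity.Theses.ExactWindowRungThree.DerivativeEnclosureCertificateR :=
  TV.k1bDR_of_checksVWinP kitOf wT sc A B B'' hcoef hS hSN hk hC hK hE
    (readoutsVP_of_checks' (sc := sc) (WV := WV) (G := G) (ΛT := ΛT) hk hchk' hR4
      (fun j hj => ⟨(hR0 j hj).1, (hR0 j hj).2.1, (hR0 j hj).2.2.1, (hR0 j hj).2.2.2, TV.sigma_trunc_VW kitOf wT sc j⟩)
      hR1 hR2 hR3a hR3b
      (fun _ hj q ζ hq hqζ _ hc => TV.hentry_of_checkEntryV kitOf wT sc hE hj q ζ hq hqζ hc))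

/-- **THE P-WINDOWED v3 CLOSER FROM BOOLEANS, v1 GROWTH RUNS** (`growthRange`): as `k1bDR_of_checksVRG'` with the read-out Boolean
`checkReadoutsWinP'`. [folklore] -/
theorem k1bDR_of_checksVRGWinP' (sc : ScalarsV) (WV : WindowsV) (A : ReadoutAux QS2) (B : StageAux QS2) (B'' : StaticAux QS2)
    (hcoef : TV.base.checkCoef = true) (hS : TV.base.checkStatic B'' = true)
    (hSN : TV.base.checkStageNumerics A B = true) (hk : KitOK TV kitOf)
    (hnode0 : ∀ j, j ≤ TV.base.N₀ → nodeOK TV.base.n TV.prec (TV.ctxOfW kitOf wT j).N0 = true)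
    (hrB : ∀ j, j ≤ TV.base.N₀ → nonnegVec TV.base.n (TV.stageV j).rB = true)
    (hK : CoreChecksOK TV wT) (hE : ∀ j, j ≤ TV.base.N₀ → TV.checkEntryV j = true)
    (hchk' : TV.checkReadoutsWinP' kitOf wT A WV = true) {L : ℕ} (hL : 0 < L)
    (hGR : ∀ j, j ≤ TV.base.N₀ → ∀ q, q * L < TV.S j →
      TV.growthRange kitOf wT (fun _ co => TV.base.testR4 TV.MB (TV.AB j) co) j L q = true)
    (hcL : ∀ j, j ≤ TV.base.N₀ → TV.checkL1 j = true) (hc0 : ∀ j, j ≤ TV.base.N₀ → TV.checkR0 j = true)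
    (hc1 : ∀ j, j ≤ TV.base.N₀ → TV.checkR1 wT j = true) :
    Summit.NavierStokesRegularity.NavierStokesRegularity.Theses.ExactWindowRungThree.DerivativeEnclosureCertificateR :=
  have hsteps := steps_of_growth (TV := TV) (kitOf := kitOf) (wT := wT)
    (Pj := fun j _ co => TV.base.testR4 TV.MB (TV.AB j) co) hL hGR
  TV.k1bDR_of_checksVRWinP' kitOf wT sc WV A B B'' hcoef hS hSN hk ⟨hnode0, hrB, fun j hj s hs => (hsteps j hj s hs).1⟩ hK hE hchk'
    (fun j hj s hs => (hsteps j hj s hs).2) (G := fun j => TV.Gr kitOf wT j L) (ΛT := TV.ΛTr)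
    (hR0_all (sc := sc) hc0) (hR1_all (sc := sc) hc1)
    (hR2_all (sc := sc) hL hGR (TV.stageNumerics_of_checkV kitOf wT sc A B hcoef hSN))
    (hR3a_all (sc := sc) hL hGR) (hR3b_all (sc := sc) hL hGR hcL)

/-- **THE P-WINDOWED v3 CLOSER FROM BOOLEANS, FAST v1 GROWTH RUNS** (`growthRangeF = growthRange`). [folklore] -/
theorem k1bDR_of_checksVRGFWinP' (sc : ScalarsV) (WV : WindowsV) (A : ReadoutAux QS2) (B : StageAux QS2) (B'' : StaticAux QS2)
    (hcoef : TV.base.checkCoef = true) (hS : TV.base.checkStatic B'' = true)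
    (hSN : TV.base.checkStageNumerics A B = true) (hk : KitOK TV kitOf)
    (hnode0 : ∀ j, j ≤ TV.base.N₀ → nodeOK TV.base.n TV.prec (TV.ctxOfW kitOf wT j).N0 = true)
    (hrB : ∀ j, j ≤ TV.base.N₀ → nonnegVec TV.base.n (TV.stageV j).rB = true)
    (hK : CoreChecksOK TV wT) (hE : ∀ j, j ≤ TV.base.N₀ → TV.checkEntryV j = true)
    (hchk' : TV.checkReadoutsWinP' kitOf wT A WV = true) {L : ℕ} (hL : 0 < L)
    (hGR : ∀ j, j ≤ TV.base.N₀ → ∀ q, q * L < TV.S j →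
      TV.growthRangeF kitOf wT (fun _ co => TV.base.testR4 TV.MB (TV.AB j) co) j L q = true)
    (hcL : ∀ j, j ≤ TV.base.N₀ → TV.checkL1 j = true) (hc0 : ∀ j, j ≤ TV.base.N₀ → TV.checkR0 j = true)
    (hc1 : ∀ j, j ≤ TV.base.N₀ → TV.checkR1 wT j = true) :
    Summit.NavierStokesRegularity.NavierStokesRegularity.Theses.ExactWindowRungThree.DerivativeEnclosureCertificateR :=
  TV.k1bDR_of_checksVRGWinP' kitOf wT sc WV A B B'' hcoef hS hSN hk hnode0 hrB hK hE hchk' hL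
    (fun j hj q hq => by rw [← growthRangeF_eq]; exact hGR j hj q hq) hcL hc0 hc1

/-- **THE P-WINDOWED v3 CLOSER FROM BOOLEANS, GROWTH VARIANT C** (interval chunk transfers, `growthRangeC`; `G := GrC … L`) — the
generator's entry point of record (`checkReadoutsWinP'` + this closer). [folklore] -/
theorem k1bDR_of_checksVRGCWinP' (sc : ScalarsV) (WV : WindowsV) (A : ReadoutAux QS2) (B : StageAux QS2) (B'' : StaticAux QS2)
    (hcoef : TV.base.checkCoef = true) (hS : TV.base.checkStatic B'' = true)
    (hSN : TV.base.checkStageNumerics A B = true) (hk : KitOK TV kitOf)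
    (hnode0 : ∀ j, j ≤ TV.base.N₀ → nodeOK TV.base.n TV.prec (TV.ctxOfW kitOf wT j).N0 = true)
    (hrB : ∀ j, j ≤ TV.base.N₀ → nonnegVec TV.base.n (TV.stageV j).rB = true)
    (hK : CoreChecksOK TV wT) (hE : ∀ j, j ≤ TV.base.N₀ → TV.checkEntryV j = true)
    (hchk' : TV.checkReadoutsWinP' kitOf wT A WV = true) {L : ℕ} (hL : 0 < L)
    (hGR : ∀ j, j ≤ TV.base.N₀ → ∀ q, q * L < TV.S j →
      TV.growthRangeC kitOf wT (fun _ co => TV.base.testR4 TV.MB (TV.AB j) co) j L q = true)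
    (hcL : ∀ j, j ≤ TV.base.N₀ → TV.checkL1 j = true) (hc0 : ∀ j, j ≤ TV.base.N₀ → TV.checkR0 j = true)
    (hc1 : ∀ j, j ≤ TV.base.N₀ → TV.checkR1 wT j = true) :
    Summit.NavierStokesRegularity.NavierStokesRegularity.Theses.ExactWindowRungThree.DerivativeEnclosureCertificateR :=
  have hsteps := steps_of_growthC (TV := TV) (kitOf := kitOf) (wT := wT)
    (Pj := fun j _ co => TV.base.testR4 TV.MB (TV.AB j) co) hL hGR
  TV.k1bDR_of_checksVRWinP' kitOf wT sc WV A B B'' hcoef hS hSN hk ⟨hnode0, hrB, fun j hj s hs => (hsteps j hj s hs).1⟩ hK hE hchk'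
    (fun j hj s hs => (hsteps j hj s hs).2) (G := fun j => TV.GrC kitOf wT j L) (ΛT := TV.ΛTr)
    (hR0_all (sc := sc) hc0) (hR1_all (sc := sc) hc1)
    (hR2_allC (sc := sc) hL hGR (TV.stageNumerics_of_checkV kitOf wT sc A B hcoef hSN))
    (hR3a_allC (sc := sc) hL hGR) (hR3b_allC (sc := sc) hL hcL hGR)

/-- **THE P-WINDOWED v3 CLOSER FROM BOOLEANS, GROWTH VARIANT C, PER-STAGE CHUNK LENGTH `Lj j`** (stages re-emitted on another growth
grid assemble with the rest). [folklore] -/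
theorem k1bDR_of_checksVRGCWinPL' (sc : ScalarsV) (WV : WindowsV) (A : ReadoutAux QS2) (B : StageAux QS2) (B'' : StaticAux QS2)
    (hcoef : TV.base.checkCoef = true) (hS : TV.base.checkStatic B'' = true)
    (hSN : TV.base.checkStageNumerics A B = true) (hk : KitOK TV kitOf)
    (hnode0 : ∀ j, j ≤ TV.base.N₀ → nodeOK TV.base.n TV.prec (TV.ctxOfW kitOf wT j).N0 = true)
    (hrB : ∀ j, j ≤ TV.base.N₀ → nonnegVec TV.base.n (TV.stageV j).rB = true)
    (hK : CoreChecksOK TV wT) (hE : ∀ j, j ≤ TV.base.N₀ → TV.checkEntryV j = true)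
    (hchk' : TV.checkReadoutsWinP' kitOf wT A WV = true) (Lj : ℕ → ℕ) (hL : ∀ j, 0 < Lj j)
    (hGR : ∀ j, j ≤ TV.base.N₀ → ∀ q, q * Lj j < TV.S j →
      TV.growthRangeC kitOf wT (fun _ co => TV.base.testR4 TV.MB (TV.AB j) co) j (Lj j) q = true)
    (hcL : ∀ j, j ≤ TV.base.N₀ → TV.checkL1 j = true) (hc0 : ∀ j, j ≤ TV.base.N₀ → TV.checkR0 j = true)
    (hc1 : ∀ j, j ≤ TV.base.N₀ → TV.checkR1 wT j = true) :
    Summit.NavierStokesRegularity.NavierStokesRegularity.Theses.ExactWindowRungThree.DerivativeEnclosureCertificateR :=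
  have hsteps : ∀ j, j ≤ TV.base.N₀ → ∀ s, s < TV.S j →
      ((TV.ctxOfW kitOf wT j).subStep s ((TV.ctxOfW kitOf wT j).nodeAt s)).ok = true ∧
      (fun _ co => TV.base.testR4 TV.MB (TV.AB j) co) s ((TV.ctxOfW kitOf wT j).subStep s ((TV.ctxOfW kitOf wT j).nodeAt s)).core = true :=
    fun j hj _ hs =>
      have h := facts_atC (TV := TV) (kitOf := kitOf) (wT := wT) (hL j) (hGR j hj) hs
      ⟨h.1, h.2.1⟩
  have hSNr := TV.stageNumerics_of_checkV kitOf wT sc A B hcoef hSN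
  TV.k1bDR_of_checksVRWinP' kitOf wT sc WV A B B'' hcoef hS hSN hk ⟨hnode0, hrB, fun j hj s hs => (hsteps j hj s hs).1⟩ hK hE hchk'
    (fun j hj s hs => (hsteps j hj s hs).2) (G := fun j => TV.GrC kitOf wT j (Lj j)) (ΛT := TV.ΛTr)
    (hR0_all (sc := sc) hc0) (hR1_all (sc := sc) hc1)
    (fun j hj s₀ s₁ h01 hS' Ac hA v r hr hv =>
      hR2_of_growthC (sc := sc) (hL j) (hGR j hj) (hSNr.1 j hj).2.2.2.2.2.2.1 s₀ s₁ h01 hS' Ac hA v r hr hv)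
    (fun j hj a b ha hab hb => hR3a_of_growthC (sc := sc) (hL j) (hGR j hj) a b ha hab hb)
    (fun j hj a ha => hR3b_of_growthC (sc := sc) (hL j) (hGR j hj) (hcL j hj) a ha)

end CertTablesV

end Summit.NavierStokesRegularity.NavierStokesRegularity.Theorems.TaylorModelCert
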